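import Summits.AtomisticToContinuum.Crystallization.Theorems.ChargedEnergyGapStackingClass
import HarnessLib

/-!
(SPLIT FOR THE 400-LINE CAP by the landing lane, hand-2 g34: this file = part 1 of 2; sequels `…ChargedEnergyGapRegistryRigidity` import it in a chain; same namespace, all FQNs unchanged.)
# Charged energy gap — lens-3 g67, «RegistryRigidity»: [VIR-red] and [VIR] PROVED — the analytic half of [CLS] reduced to three summability / interval certificates

Cell `decomp-a2c`, seat lens-3, generation 67, part P-N⁗·b (over node «StackingClass» `…Theorems.ChargedEnergyGapStackingClass`, critic row 1278
CLEARED; this file is an APPEND to it: same namespace, imports it).  ELEMENTARY·PROVED; 0 sorry; standard axioms.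

WHAT IT DOES.  Node «StackingClass» typed the analytic half [CLS-an] `BarlowRegistryRigidity` of the classification [CLS] and beneath it the
interval target [DOM] `LayerDominance` and the reduction [VIR-red] `RegistryRigidityOfDominance` ([DOM] ⟹ [CLS-an]), whose informal proof was
«the normal–normal site virial regroups by layers as `τ₀ + Σ_{j≥2} n_j(m)·δ_j`; two sites give `Σ (n_j(m) − n_j(m′))·δ_j = 0` with integer
coefficients in `[-2, 2]`; dominance `|δ₂| > 2Σ_{j≥3}|δ_j|`, `|δ₃| > 2Σ_{j≥4}|δ_j|` peels `j = 2, 3`».  This file PROVES that chain in Lean: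
* §V1 types the layer-sum identity [VIR] `LayerVirialIdentity` (with the all-offset baseline `baselineNN`) and the summability licence [VIR-sum]
  `LayerDeltaSummable` (`j ↦ δ_j^⊥(a,h)` summable);
* §V2 ★ `int_coeff_eq_zero_of_dominance` — THE PEELING LEMMA: `Σ_j D_j δ_j = 0`, `D_j ∈ ℤ ∩ [-2, 2]`, `2Σ_{j>k}|δ_j| < |δ_k|` ⟹ `D_k = 0` and the
  tail identity persists; `int_coeff_two_three_eq_zero`;
* §V3 ★★ `registryRigidityOfDominance_of_identity : LayerVirialIdentity → LayerDeltaSummable → RegistryRigidityOfDominance` ([VIR-red] PROVED from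
  [VIR] ∧ [VIR-sum]): rigid presentation of the Barlow image (`exists_linearIsometryEquiv_add_of_isometry`), site-stress-freeness at every site
  (`IsSiteStressFree.siteVirial_eq_zero`), difference of the two identities (`registryDifference_eq_zero`), peeling;
* §V4 ★★ `layerVirialIdentity_of_summable : BarlowVirialSummable → LayerDeltaSummable → LayerVirialIdentity` ([VIR] PROVED from the single
  summability statement [VIR-fub] `BarlowVirialSummable` — absolute summability over `ℤ³` of the explicit family `virialTermNN`): pull-back through
  the presentation (`siteVirial_presentation`), re-indexing by `ℤ³` (`barlowPos_injective`, `barlowEquiv`, `tsum_barlowStacking_punctured`),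
  Fubini over layers (`Summable.tsum_prod`), per-layer re-indexing into registry classes (`tsum_layer_virialTermNN`: absorb `3q` Hägg letters into
  the in-layer translation `q(u+v)`; class `t mod 3`, `layerSumNN_two`: the classes `t = 2` and `t = 1` agree), fold `ℤ → ℕ` and pairing of the
  layers `m ± j` (`layer_pair_eq`: `= 2·(offset) + n_j(m)·δ_j`), `n₁ = 0` (`alignedPairs_one`).
NET: ★★ `barlowStressFreeClassification_of_dominance_summable : LayerDominance → BarlowVirialSummable → LayerDeltaSummable →
BarlowStressFreeClassification` — [CLS] ⟸ [DOM] ∧ [VIR-fub] ∧ [VIR-sum]: no Hägg-word combinatorics and no virial bookkeeping remain; what is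
owed beneath [CLS] is interval arithmetic on explicit lattice sums ([DOM], floats `num/delta_layers.out`: margins ≥ 98 %) and two summability
estimates of `(d⁻¹² + d⁻⁶)`-type lattice sums ([VIR-fub] over `ℤ³`, [VIR-sum] over layers `j`, each `O((jh)⁻⁴)`).
-/

noncomputable section

open scoped Classical
open Literature.MathematicalPhysics.StatisticalMechanics Literature.Geometry.DiscreteGeometry
open Summit.AtomisticToContinuum.Crystallization.Theses.PricedLinkCensus
open Summit.AtomisticToContinuum.Crystallization.Theorems.ChargedEnergyGapNegative

namespace Summit.AtomisticToContinuum.Crystallization.Theorems.ChargedEnergyGapChartDial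

/-! ## §V1 [VIR] and [VIR-sum] TYPED: the layer-sum identity of the normal–normal site virial of a Barlow presentation -/

section VirialIdentity

/-- The ALL-OFFSET BASELINE `τ₀^⊥(a, h) := 2·Σ_{j ≥ 1} layerSumNN a h j 1` — the normal–normal site virial a site WOULD have if every other
layer were out of registry with it (layers `±j` contribute equally; `j = 1` is always out of registry for a Hägg word). -/
def baselineNN (a h : ℝ) : ℝ :=
  2 * ∑' j : ℕ, layerSumNN a h (j + 1) 1

/-- ★ piece [VIR] · PROVED modulo the summability licences [VIR-fub] ∧ [VIR-sum] (§V4 `layerVirialIdentity_of_summable`) · **THE LAYER-SUM IDENTITY**: for a periodic presentation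
`P.points = L '' barlowStacking a h s + c` (`L` a linear isometry, `c` a translation) of a Hägg stacking and a site `y` of layer `m`, the
normal–normal site virial in the image normal `n = L e₃` regroups by layers as
`T_{L y + c}(n, n) = τ₀^⊥(a, h) + Σ_{j ≥ 2} n_j(m)·δ_j^⊥(a, h)` with `n_j(m) = alignedPairs s j m ∈ {0, 1, 2}` (layers `m ± j` in registry with
layer `m` contribute `layerSumNN a h j 0`, the others `layerSumNN a h j (±1) = layerSumNN a h j 1` by `layerSumNN_neg_one`; `n₁ = 0` by
`not_haggLabel_modEq_succ`).  Ingredients in the tree: `siteVirial_symm` (pull back through the isometry), `mem_barlowStacking_iff` /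
`dist_barlowPos_sq` (re-index by `ℤ³`), `barlowLayer_add_eq_image_of_haggAligned` + `three_smul_barlowOffset` (registry class = Hägg alignment),
`summable_virial` (absolute convergence, Fubini over layers).  Why it might fail: it cannot (an identity between absolutely convergent sums);
the work is the summability bookkeeping — DONE in §V4 down to the one summability statement [VIR-fub] `BarlowVirialSummable`. -/
def LayerVirialIdentity : Prop :=
  ∀ (P : PeriodicConfiguration 3) (a h : ℝ) (s : ℤ → ℤ) (L : E3 ≃ₗᵢ[ℝ] E3) (c : E3),
    0 < a → 0 < h → IsHaggSeq s → P.points = (fun x => L x + c) '' barlowStacking a h s →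
      ∀ (m : ℤ) (y : E3), y ∈ barlowLayer a h s m →
        siteVirial P (L y + c) (L (layerNormal 1)) (L (layerNormal 1)) =
          baselineNN a h + ∑' j : ℕ, (alignedPairs s (j + 2) m : ℝ) * layerDeltaNN a h (j + 2)

/-- ★ piece [VIR-sum] · UNDECIDED · TRUE · CERT-able / ANALYTIC-S · **SUMMABILITY OF THE REGISTRY CONTRASTS**: `j ↦ δ_j^⊥(a, h)` is summable for
`a, h > 0` (each layer sum is `O((jh)⁻⁴)`; rides with DOM-cert: bounded partial sums of `|δ_j|` give it by `summable_of_sum_le`).  Needed to split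
`Σ (n_j(m) − n_j(m′))·δ_j` into the two site identities.  Why it might fail: it cannot for `h > 0`. -/
def LayerDeltaSummable : Prop :=
  ∀ a h : ℝ, 0 < a → 0 < h → Summable fun j : ℕ => layerDeltaNN a h j

end VirialIdentity

/-! ## §V2 ★★ [VIR-red] PROVED from [VIR] ∧ [VIR-sum]: dominance forces a uniform registry -/

section Dominance

/-- The registry profile takes values in `{0, 1, 2}`. [formal bookkeeping] -/
theorem alignedPairs_le_two (s : ℤ → ℤ) (j : ℕ) (m : ℤ) : alignedPairs s j m ≤ 2 := by
  unfold alignedPairs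
  split_ifs <;> norm_num

/-- Hence registry DIFFERENCES are integers of modulus `≤ 2`. [formal bookkeeping] -/
theorem abs_alignedPairs_sub_le (s : ℤ → ℤ) (j : ℕ) (m m' : ℤ) :
    |((alignedPairs s j m : ℤ) - alignedPairs s j m' : ℤ)| ≤ 2 := by
  have h1 := alignedPairs_le_two s j m
  have h2 := alignedPairs_le_two s j m'
  rw [abs_le]
  constructor <;> omega

/-- ★ **ONE ELIMINATION STEP**: if `Σ_{j ≥ k} D_j δ_j = 0` with integer `|D_j| ≤ 2`, `δ` summable and the DOMINANCE `2·Σ_{j ≥ k+1} |δ_j| < |δ_k|`,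
then `D_k = 0` — and therefore `Σ_{j ≥ k+1} D_j δ_j = 0`, ready for the next step. -/
theorem int_coeff_eq_zero_of_dominance {δ : ℕ → ℝ} {D : ℕ → ℤ} (k : ℕ) (hδ : Summable δ) (hD : ∀ j, |D j| ≤ 2)
    (h0 : ∑' j : ℕ, (D (j + k) : ℝ) * δ (j + k) = 0) (hdom : 2 * ∑' j : ℕ, |δ (j + (k + 1))| < |δ k|) :
    D k = 0 ∧ ∑' j : ℕ, (D (j + (k + 1)) : ℝ) * δ (j + (k + 1)) = 0 := by
  have hDr : ∀ j, |(D j : ℝ)| ≤ 2 := fun j => by exact_mod_cast hD j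
  -- summability of the shifted families
  have hδk : Summable fun j : ℕ => δ (j + k) := (summable_nat_add_iff k).mpr hδ
  have hδk1 : Summable fun j : ℕ => |δ (j + (k + 1))| := ((summable_nat_add_iff (k + 1)).mpr hδ).abs
  have hF : Summable fun j : ℕ => (D (j + k) : ℝ) * δ (j + k) := by
    refine Summable.of_norm_bounded (hδk.abs.mul_left 2) fun j => ?_
    rw [Real.norm_eq_abs, abs_mul]
    exact mul_le_mul_of_nonneg_right (hDr _) (abs_nonneg _)
  -- split off the first term
  have hsplit := hF.tsum_eq_zero_add
  have hre : (fun j : ℕ => (D (j + 1 + k) : ℝ) * δ (j + 1 + k)) = fun j : ℕ => (D (j + (k + 1)) : ℝ) * δ (j + (k + 1)) := by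
    funext j; rw [show j + 1 + k = j + (k + 1) by omega]
  rw [h0, zero_add, hre] at hsplit
  -- hsplit : 0 = D k * δ k + ∑' j, D (j+(k+1)) * δ (j+(k+1))
  have hT : Summable fun j : ℕ => (D (j + (k + 1)) : ℝ) * δ (j + (k + 1)) := by
    refine Summable.of_norm_bounded (hδk1.mul_left 2) fun j => ?_
    rw [Real.norm_eq_abs, abs_mul]
    exact mul_le_mul_of_nonneg_right (hDr _) (abs_nonneg _)
  have hTabs : Summable fun j : ℕ => |(D (j + (k + 1)) : ℝ) * δ (j + (k + 1))| := hT.abs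
  have hbound : |∑' j : ℕ, (D (j + (k + 1)) : ℝ) * δ (j + (k + 1))| ≤ 2 * ∑' j : ℕ, |δ (j + (k + 1))| := by
    calc |∑' j : ℕ, (D (j + (k + 1)) : ℝ) * δ (j + (k + 1))|
        ≤ ∑' j : ℕ, |(D (j + (k + 1)) : ℝ) * δ (j + (k + 1))| := by
          have h := norm_tsum_le_tsum_norm (f := fun j : ℕ => (D (j + (k + 1)) : ℝ) * δ (j + (k + 1))) (by simpa [Real.norm_eq_abs] using hTabs)
          simpa [Real.norm_eq_abs] using h
      _ ≤ ∑' j : ℕ, 2 * |δ (j + (k + 1))| := by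
          refine Summable.tsum_le_tsum (fun j => ?_) hTabs (hδk1.mul_left 2)
          rw [abs_mul]
          exact mul_le_mul_of_nonneg_right (hDr _) (abs_nonneg _)
      _ = 2 * ∑' j : ℕ, |δ (j + (k + 1))| := tsum_mul_left
  have hprod : |(D k : ℝ)| * |δ k| < |δ k| := by
    have h1 : (D k : ℝ) * δ k = -∑' j : ℕ, (D (j + (k + 1)) : ℝ) * δ (j + (k + 1)) := by linarith
    rw [← abs_mul, h1, abs_neg]
    exact lt_of_le_of_lt hbound hdom
  have hDk : |(D k : ℝ)| < 1 := by
    by_contra hc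
    have hc : 1 ≤ |(D k : ℝ)| := not_lt.mp hc
    have : |δ k| ≤ |(D k : ℝ)| * |δ k| := le_mul_of_one_le_left (abs_nonneg _) hc
    linarith
  have hDk0 : D k = 0 := by
    have : |D k| < 1 := by exact_mod_cast hDk
    exact Int.abs_lt_one_iff.mp this
  refine ⟨hDk0, ?_⟩
  have : (D k : ℝ) * δ k = 0 := by rw [hDk0]; simp
  linarith

/-- ★ **TWO STEPS**: under [DOM]-type dominance at ranges `2` and `3`, `Σ_{j ≥ 2} D_j δ_j = 0` with integer `|D_j| ≤ 2` forces `D₂ = D₃ = 0`. -/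
theorem int_coeff_two_three_eq_zero {δ : ℕ → ℝ} {D : ℕ → ℤ} (hδ : Summable δ) (hD : ∀ j, |D j| ≤ 2)
    (h0 : ∑' j : ℕ, (D (j + 2) : ℝ) * δ (j + 2) = 0)
    (h2 : 2 * ∑' j : ℕ, |δ (j + 3)| < |δ 2|) (h3 : 2 * ∑' j : ℕ, |δ (j + 4)| < |δ 3|) : D 2 = 0 ∧ D 3 = 0 := by
  obtain ⟨hD2, h0'⟩ := int_coeff_eq_zero_of_dominance 2 hδ hD h0 h2
  obtain ⟨hD3, _⟩ := int_coeff_eq_zero_of_dominance 3 hδ hD h0' h3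
  exact ⟨hD2, hD3⟩

end Dominance

/-! ## §V3 ★★ The glue: [VIR] ∧ [VIR-sum] ⟹ [VIR-red] (so [CLS-an] ⟸ [VIR] ∧ [VIR-sum] ∧ [DOM], all three certificate/bookkeeping-grade) -/

section Glue

variable {P : PeriodicConfiguration 3}

/-- Every isometry of `E3` is `x ↦ L x + c` with `L` a linear isometry (Mazur–Ulam / `Isometry.affineIsometryOfStrictConvexSpace`).  (Same
content as `Fcc.exists_linearIsometryEquiv_of_isometry` of `…ChargedEnergyGapAffineStabilityFcc`; restated here to keep the imports disjoint —
`private` per the gate's dedup rule, landing lane hand-2 g34.) -/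
private theorem exists_linearIsometryEquiv_add_of_isometry {g : E3 → E3} (hg : Isometry g) :
    ∃ (L : E3 ≃ₗᵢ[ℝ] E3) (c : E3), ∀ x, g x = L x + c := by
  let F : E3 →ᵃⁱ[ℝ] E3 := hg.affineIsometryOfStrictConvexSpace
  have hF : ∀ x, F x = g x := fun x => rfl
  let L : E3 ≃ₗᵢ[ℝ] E3 := F.linearIsometry.toLinearIsometryEquiv rfl
  have hL : ∀ v, L v = F.linearIsometry v := fun v => F.linearIsometry.toLinearIsometryEquiv_apply rfl v
  refine ⟨L, g 0, fun x => ?_⟩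
  have h1 : F x = F.linearIsometry (x -ᵥ (0 : E3)) +ᵥ F 0 := by rw [← F.map_vadd, vsub_vadd]
  rw [← hF x, h1, ← hF 0, vsub_eq_sub, sub_zero, vadd_eq_add, hL]

/-- ★ THE REGISTRY DIFFERENCE IDENTITY: under [VIR] ∧ [VIR-sum], for a site-stress-free presentation the registry-weighted contrast sums of any two
layers agree: `Σ_{j ≥ 2} (n_j(m) − n_j(m′))·δ_j^⊥ = 0`. -/
theorem registryDifference_eq_zero (hV : LayerVirialIdentity) (hSum : LayerDeltaSummable) {a h : ℝ} {s : ℤ → ℤ} (L : E3 ≃ₗᵢ[ℝ] E3) (c : E3)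
    (ha : 0 < a) (hh : 0 < h) (hH : IsHaggSeq s) (hP : P.points = (fun x => L x + c) '' barlowStacking a h s) (hS : IsSiteStressFree P)
    (m m' : ℤ) :
    ∑' j : ℕ, (((alignedPairs s (j + 2) m : ℤ) - alignedPairs s (j + 2) m' : ℤ) : ℝ) * layerDeltaNN a h (j + 2) = 0 := by
  -- the two site identities, at the layer origins
  have hy : ∀ n : ℤ, barlowPos a h s n 0 0 ∈ barlowLayer a h s n := fun n => ⟨0, 0, rfl⟩
  have hz : ∀ n : ℤ, L (barlowPos a h s n 0 0) + c ∈ P.points := fun n => by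
    rw [hP]; exact ⟨_, barlowPos_mem n 0 0, rfl⟩
  have hid : ∀ n : ℤ, baselineNN a h + ∑' j : ℕ, (alignedPairs s (j + 2) n : ℝ) * layerDeltaNN a h (j + 2) = 0 := fun n => by
    rw [← hV P a h s L c ha hh hH hP n _ (hy n)]
    exact hS.siteVirial_eq_zero (hz n) _ _
  -- summability of the registry-weighted families
  have hδ2 : Summable fun j : ℕ => layerDeltaNN a h (j + 2) := (summable_nat_add_iff 2).mpr (hSum a h ha hh)
  have hsum : ∀ n : ℤ, Summable fun j : ℕ => (alignedPairs s (j + 2) n : ℝ) * layerDeltaNN a h (j + 2) := fun n => by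
    refine Summable.of_norm_bounded (hδ2.abs.mul_left 2) fun j => ?_
    rw [Real.norm_eq_abs, abs_mul]
    refine mul_le_mul_of_nonneg_right ?_ (abs_nonneg _)
    rw [Nat.abs_cast]
    exact_mod_cast alignedPairs_le_two s (j + 2) n
  have heq : ∑' j : ℕ, (alignedPairs s (j + 2) m : ℝ) * layerDeltaNN a h (j + 2) =
      ∑' j : ℕ, (alignedPairs s (j + 2) m' : ℝ) * layerDeltaNN a h (j + 2) := by linarith [hid m, hid m']
  have hsub := (hsum m).tsum_sub (hsum m')
  rw [heq, sub_self] at hsub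
  rw [← hsub]
  refine tsum_congr fun j => ?_
  push_cast
  ring

/-- ★★ **[VIR-red] FROM [VIR] ∧ [VIR-sum]** (PROVED): the layer-sum identity and the summability of the contrasts reduce the registry rigidity
[CLS-an] to layer dominance [DOM].  With `barlowStressFreeClassification_of_dominance`: [CLS] ⟸ [DOM] ∧ [VIR] ∧ [VIR-sum]. -/
theorem registryRigidityOfDominance_of_identity (hV : LayerVirialIdentity) (hSum : LayerDeltaSummable) : RegistryRigidityOfDominance := by
  intro hD P a h s g ha hh hH hg hP hS
  obtain ⟨L, c, hLc⟩ := exists_linearIsometryEquiv_add_of_isometry hg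
  have hg' : g = fun x => L x + c := funext hLc
  subst hg'
  have ha0 : 0 < a := by linarith [ha.1]
  obtain ⟨hdom2, hdom3⟩ := hD a h ha hh
  have hδ : Summable fun j : ℕ => layerDeltaNN a h j := hSum a h ha0 hh.1
  have key : ∀ m : ℤ, alignedPairs s 2 m = alignedPairs s 2 0 ∧ alignedPairs s 3 m = alignedPairs s 3 0 := fun m => by
    have h0 := registryDifference_eq_zero hV hSum L c ha0 hh.1 hH hP hS m 0
    obtain ⟨h2, h3⟩ := int_coeff_two_three_eq_zero (D := fun j => (alignedPairs s j m : ℤ) - alignedPairs s j 0) hδ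
      (fun j => abs_alignedPairs_sub_le s j m 0) h0 hdom2 hdom3
    constructor <;> omega
  exact ⟨fun m => (key m).1, fun m => (key m).2⟩

/-- COROLLARY: [CLS-an] ⟸ [DOM] ∧ [VIR] ∧ [VIR-sum]. -/
theorem barlowRegistryRigidity_of_dominance_identity (hD : LayerDominance) (hV : LayerVirialIdentity) (hSum : LayerDeltaSummable) :
    BarlowRegistryRigidity :=
  registryRigidityOfDominance_of_identity hV hSum hD

/-- COROLLARY: [CLS] ⟸ [DOM] ∧ [VIR] ∧ [VIR-sum] (with the PROVED [CLS-comb]). -/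
theorem barlowStressFreeClassification_of_dominance_identity (hD : LayerDominance) (hV : LayerVirialIdentity) (hSum : LayerDeltaSummable) :
    BarlowStressFreeClassification :=
  barlowStressFreeClassification_of_dominance hD (registryRigidityOfDominance_of_identity hV hSum)

end Glue

end Summit.AtomisticToContinuum.Crystallization.Theorems.ChargedEnergyGapChartDial
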